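import Summits.QuantumFields.YangMills.Theorems.SwapVirialDeficitBlowUpChartDeficitGrowthTwisted
import Summits.QuantumFields.YangMills.Theorems.SwapVirialDeficitBlowUpChartDeficitGrowth
import Summits.QuantumFields.YangMills.Theorems.SwapVirialDeficitBlowUpGnomonicDeficitDefs
import Summits.QuantumFields.YangMills.Theorems.ToronValleyVolumeLojasiewiczLocaliseSeam
import Literature.MathematicalPhysics.QuantumFieldTheory.Balaban1983to89.T4ExpWindowSmallField
import HarnessLib

/-!
# NON-PLUS FOLLOWER SIGN PATTERNS ARE LARGE FIELD: a follower in the negative hemisphere costs `F̂_z ≥ 1/(576·L⁶)`, every sector, every hub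
# (free-hands support of ⟨stmt-QuantumFields-24197⟩ `SwapVirialDeficit.SwapGluedStiffness`; the `Σ_ε` over hemisphere signs in the gnomonic ring integral
# `Ẑ = K_L ∫_cone Σ_ε ∫ e^{−bF̂(a,ε,η)} gnoDensity dη` of LEAD ym-line-sfw-p2 g97's steep-window plan — «non-flat patterns are large-field» made quantitative)

In the gnomonic ring chart (✓`BlowUpRing.gnomonicPoint`, ✓`gnoLetter ε v = ±(1, v)`) a follower with hemisphere sign `ε_i = false` is the `SU(2)` element
`U_i = −(1, v)/‖(1, v)‖` whose quaternion has NEGATIVE real part, hence `‖q(U_i) − 1‖² = 2 − 2·re ≥ 2`, `‖U_i − 1‖²_F = 2‖q(U_i) − 1‖² ≥ 4` (✓`fd_sq_eq_two_mul`,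
lit ✓`T4ExpWindowSmallField.norm_sub_one_sq`), and the follower separation ✓`chartDeficit[_twisted]_ge_of_follower_far` (`R²/(2304L⁶) ≤ F̂`) gives `F̂ ≥ 4/(2304L⁶)`:
* §1 ★ `two_le_frobNorm_sub_one_of_re_nonpos` (`re q(U) ≤ 0 ⟹ 2 ≤ ‖U − 1‖_F`), `re_su2Quat_gnoFollower_false_neg`, ★ `two_le_frobNorm_gnoFollower_false_sub_one`;
* §2 ★★ `chartDeficit_twisted_ge_of_follower_sign_false` ∕ `chartDeficit_ge_of_follower_sign_false` — a chart point one of whose followers is `quatToSU2 (gnoLetter false v)` has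
  `1/(576·L⁶) ≤ F̂_z` (every sector `z` with the sector character `χ_z`; principal chart `χ ≡ 1`);
* §3 ★★★ `gnoDeficit_ge_of_follower_sign_false (z) (a ε η) (hi : ε.2.2 i = false) : 1/(576·L⁶) ≤ gnoDeficit z χ_z a ε η` and the principal twin
  `gnoDeficit_one_ge_of_follower_sign_false` — uniformly in the hub `a`, the other signs and all coordinates: on the steep window `b ≥ poly(L)` the `2^{|Fol L|} − 1`
  non-plus follower patterns contribute `≤ 2^{6L⁴}·e^{−b/(576L⁶)}×(total mass)` — negligible, no Laplace analysis needed there; ★ `exp_neg_mul_gnoDeficit_le_of_follower_sign_false`.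
What is NOT here: leader hemisphere signs (flat in suitable sectors — they are part of the base), the far-region bookkeeping itself (✓`…BlowUpVirialFarRegion`).

HONEST LABEL: bookkeeping on landed inequalities; ⟨24197⟩ (window-uniform) ∕ ⟨24196⟩ ∕ ⟨24194⟩ ∕ ⟨24497⟩ OPEN; own crux ⟨22884⟩ OPEN (blocked-on ⟨19935⟩); no crux, rung of
record or summit is proved; the Yang–Mills mass gap is NOT proved; no summit is proved by a line.  THEOREMS ONLY (0 `def`, 0 `sorry`), standard axioms.
Width seat ym-line-sfw-p2-w3 g65 (cell ym-idea-1, free hands), `--supports stmt-QuantumFields-24197`.  References: [cite: Luscher1983, §2]; [folklore].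
-/

set_option autoImplicit false

noncomputable section

open MeasureTheory Quaternion
open scoped BigOperators Quaternion
open Literature.MathematicalPhysics.QuantumFieldTheory hiding SU2
open Literature.MathematicalPhysics.QuantumLattice
open Literature.MathematicalPhysics.QuantumFieldTheory.Balaban1983to89.T4ExpWindowSmallField (norm_sub_one_sq)
open Literature.Analysis.Calculus (radialUnit radialUnit_def)

namespace Summit.QuantumFields.YangMills.Theorems.SwapVirialDeficit.BlowUpRing

open Summit.QuantumFields.YangMills.Theorems.FemtoTransferGap
open Summit.QuantumFields.YangMills.Theorems.FemtoTransferGap.TT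
open Summit.QuantumFields.YangMills.Theorems.FemtoTransferGap.TwoLattice.Flat (fd)
open Summit.QuantumFields.YangMills.Theorems.VirialFluxGap.RingDeficit
open Summit.QuantumFields.YangMills.Theorems.SwapVirialDeficit.SwapRing
open Summit.QuantumFields.YangMills.Theorems.SwapVirialDeficit.ZeroModeSigma (dilateIm su2Quat_quatToSU2_eq_radialUnit)
open Summit.QuantumFields.YangMills.Theorems.SwapVirialDeficit.BlowUp (dilateIm_one_apply)
open Summit.QuantumFields.YangMills.Theorems.ToronValleyVolume.Lojasiewicz (fd_sq_eq_two_mul)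

variable {L : ℕ} [NeZero L]

/-! ## §1 Negative hemisphere ⟹ Frobenius distance `≥ 2` from the identity -/

omit [NeZero L] in
/-- ★ An `SU(2)` element whose quaternion has non-positive real part is at Frobenius distance `≥ 2` from `1` (`‖U − 1‖²_F = 4 − 4·re q(U)`). [folklore] -/
theorem two_le_frobNorm_sub_one_of_re_nonpos (U : SU2) (h : (su2Quat U).re ≤ 0) : 2 ≤ frobNorm ((U : Matrix (Fin 2) (Fin 2) ℂ) - 1) := by
  have h1 : fd U 1 ^ 2 = 2 * ‖su2Quat U - su2Quat 1‖ ^ 2 := fd_sq_eq_two_mul U 1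
  rw [su2Quat_one, norm_sub_one_sq (norm_su2Quat U)] at h1
  have hfd : fd U 1 = frobNorm ((U : Matrix (Fin 2) (Fin 2) ℂ) - 1) := by simp only [fd, OneMemClass.coe_one]
  have h0 : 0 ≤ fd U 1 := frobNorm_nonneg _
  rw [← hfd]
  have hsq : (2 : ℝ) ^ 2 ≤ fd U 1 ^ 2 := by nlinarith [h1, h]
  exact (pow_le_pow_iff_left₀ (by norm_num) h0 two_ne_zero).1 hsq

omit [NeZero L] in
/-- The negative-hemisphere gnomonic follower `U = quatToSU2 (gnoLetter false v) = −(1,v)/‖(1,v)‖` has `re q(U) < 0`. [folklore] -/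
theorem re_su2Quat_gnoFollower_false_neg (v : Fin 3 → ℝ) : (su2Quat (quatToSU2 (gnoLetter false v))).re < 0 := by
  have hne := gnoLetter_ne_zero false v
  have hn : 0 < ‖gnoLetter false v‖ := norm_pos_iff.2 hne
  rw [su2Quat_quatToSU2_eq_radialUnit hne]
  have hre : (radialUnit (gnoLetter false v)).re = ‖gnoLetter false v‖⁻¹ * (gnoLetter false v).re := by
    rw [radialUnit_def, Quaternion.re_smul, smul_eq_mul]
  rw [hre, gnoLetter_re]
  have hs : gnoSign false = -1 := by simp [gnoSign]
  rw [hs]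
  nlinarith [inv_pos.2 hn]

omit [NeZero L] in
/-- ★ A negative-hemisphere gnomonic follower is at Frobenius distance `≥ 2` from the identity. [folklore] -/
theorem two_le_frobNorm_gnoFollower_false_sub_one (v : Fin 3 → ℝ) :
    2 ≤ frobNorm (((quatToSU2 (gnoLetter false v) : SU2) : Matrix (Fin 2) (Fin 2) ℂ) - 1) :=
  two_le_frobNorm_sub_one_of_re_nonpos _ (re_su2Quat_gnoFollower_false_neg v).le

/-! ## §2 Chart level: one negative-hemisphere follower costs `F̂_z ≥ 1/(576·L⁶)` -/

/-- ★★ **Every sector**: a chart point `q = (C, U)` with some follower `U_i = quatToSU2 (gnoLetter false v)` has `1/(576·L⁶) ≤ F̂_z(C,U)`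
(`F̂_z = chartDeficit L z χ_z`, ✓`chartDeficit_twisted_ge_of_follower_far` with `R = 2`). [cite: Luscher1983, §2] -/
theorem chartDeficit_twisted_ge_of_follower_sign_false (z : Fin 3 → Bool) (q : (Fin 4 → SU2) × (Fol L → SU2)) (i : Fol L) (v : Fin 3 → ℝ)
    (hU : q.2 i = quatToSU2 (gnoLetter false v)) :
    1 / (576 * (L : ℝ) ^ 6) ≤ chartDeficit L z
      (fun x => centreElem (Bool.xor (z 0 && decide (x 0 ≠ 0)) (Bool.xor (z 1 && decide (x 1 ≠ 0)) (z 2 && decide (x 2 ≠ 0))))) q := by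
  have h := chartDeficit_twisted_ge_of_follower_far (L := L) z q i (R := 2) (by norm_num) (by rw [hU]; exact two_le_frobNorm_gnoFollower_false_sub_one v)
  calc 1 / (576 * (L : ℝ) ^ 6) = 2 ^ 2 / (2304 * (L : ℝ) ^ 6) := by ring
    _ ≤ _ := h

/-- ★★ **Principal chart** (`χ ≡ 1`): the same bound `1/(576·L⁶) ≤ F̂(C,U)` (✓`chartDeficit_ge_of_follower_far`). [cite: Luscher1983, §2] -/
theorem chartDeficit_ge_of_follower_sign_false (q : (Fin 4 → SU2) × (Fol L → SU2)) (i : Fol L) (v : Fin 3 → ℝ)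
    (hU : q.2 i = quatToSU2 (gnoLetter false v)) :
    1 / (576 * (L : ℝ) ^ 6) ≤ chartDeficit L (fun _ => false) (fun _ => 1) q := by
  have h := chartDeficit_ge_of_follower_far (L := L) q i (R := 2) (by norm_num) (by rw [hU]; exact two_le_frobNorm_gnoFollower_false_sub_one v)
  calc 1 / (576 * (L : ℝ) ^ 6) = 2 ^ 2 / (2304 * (L : ℝ) ^ 6) := by ring
    _ ≤ _ := h

/-! ## §3 Gnomonic level: non-plus follower sign patterns are uniformly large field -/

omit [NeZero L] in
/-- The follower coordinate of the gnomonic ring point: `(blowUpPoint 1 (gnomonicPoint a ε η)).2 i = quatToSU2 (gnoLetter (ε.2.2 i) (η.2.2 i))`. [folklore] -/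
theorem blowUpPoint_one_gnomonicPoint_snd (a : ℍ) (ε : GnoSign L) (η : GnoCoord L) (i : Fol L) :
    (blowUpPoint 1 (gnomonicPoint a ε η)).2 i = quatToSU2 (gnoLetter (ε.2.2 i) (η.2.2 i)) := by
  simp only [blowUpPoint, gnomonicPoint, dilateIm_one_apply]

/-- ★★★ **NON-PLUS FOLLOWER SIGN PATTERNS ARE LARGE FIELD** (every sector): if the hemisphere sign of some follower is `false`, then
`1/(576·L⁶) ≤ gnoDeficit z χ_z a ε η` — for EVERY hub `a`, all other signs and ALL gnomonic coordinates `η`. [cite: Luscher1983, §2] -/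
theorem gnoDeficit_ge_of_follower_sign_false (z : Fin 3 → Bool) (a : ℍ) (ε : GnoSign L) (η : GnoCoord L) {i : Fol L} (hi : ε.2.2 i = false) :
    1 / (576 * (L : ℝ) ^ 6) ≤ gnoDeficit z
      (fun x => centreElem (Bool.xor (z 0 && decide (x 0 ≠ 0)) (Bool.xor (z 1 && decide (x 1 ≠ 0)) (z 2 && decide (x 2 ≠ 0))))) a ε η := by
  unfold gnoDeficit
  refine chartDeficit_twisted_ge_of_follower_sign_false (L := L) z _ i (η.2.2 i) ?_
  rw [blowUpPoint_one_gnomonicPoint_snd, hi]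

/-- ★★★ **The principal twin** (`z = 000`, `χ ≡ 1`): `ε.2.2 i = false ⟹ 1/(576·L⁶) ≤ gnoDeficit 0 1 a ε η`. [cite: Luscher1983, §2] -/
theorem gnoDeficit_one_ge_of_follower_sign_false (a : ℍ) (ε : GnoSign L) (η : GnoCoord L) {i : Fol L} (hi : ε.2.2 i = false) :
    1 / (576 * (L : ℝ) ^ 6) ≤ gnoDeficit (fun _ => false) (fun _ => 1) a ε η := by
  unfold gnoDeficit
  refine chartDeficit_ge_of_follower_sign_false (L := L) _ i (η.2.2 i) ?_
  rw [blowUpPoint_one_gnomonicPoint_snd, hi]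

/-- ★ **The Boltzmann factor of a non-plus follower pattern**: `e^{−b·F̂} ≤ e^{−b/(576·L⁶)}` for `b ≥ 0` (every sector) — summed over the `< 2^{|Fol L|}` such patterns
and integrated against any finite reference mass this is the «large-field» share of the sign sum. [cite: Luscher1983, §2] -/
theorem exp_neg_mul_gnoDeficit_le_of_follower_sign_false (z : Fin 3 → Bool) (a : ℍ) (ε : GnoSign L) (η : GnoCoord L) {i : Fol L} (hi : ε.2.2 i = false)
    {b : ℝ} (hb : 0 ≤ b) :
    Real.exp (-(b * gnoDeficit z
      (fun x => centreElem (Bool.xor (z 0 && decide (x 0 ≠ 0)) (Bool.xor (z 1 && decide (x 1 ≠ 0)) (z 2 && decide (x 2 ≠ 0))))) a ε η)) ≤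
      Real.exp (-(b / (576 * (L : ℝ) ^ 6))) := by
  have h := gnoDeficit_ge_of_follower_sign_false (L := L) z a ε η hi
  rw [Real.exp_le_exp, neg_le_neg_iff]
  calc b / (576 * (L : ℝ) ^ 6) = b * (1 / (576 * (L : ℝ) ^ 6)) := by ring
    _ ≤ _ := mul_le_mul_of_nonneg_left h hb

end Summit.QuantumFields.YangMills.Theorems.SwapVirialDeficit.BlowUpRing

end
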